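import Literature.Probability.Percolation.SmirnovSeparatingData
import HarnessLib

/-!
# Route CardyBondTriangular · crux `BondTriangularCardy` (stmt-CriticalPhenomena-4664), line `birth`:
# the interpolants of WEAK separating data and the contour relation of their limits

Helper file of the analysis stub `stub_weakBoundaryUpgrade` (weak separating data are separating
data when `ω ≠ 1`). The tree's lemmas `dataFamily_approx`, `dataFamily_two_sided`,
`dataFamily_equicontinuous` and `limit_contour_of_separatingData` (`SmirnovSeparatingData.lean`,
Bollobás–Riordan 2006, Ch. 7, (39) p. 200, p. 197, Claim 22 pp. 197–198, Claim 23 (36) p. 199)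
take bundled separating data `hD : IsSeparatingData R ω S f` but use only its clauses `mem_Icc`,
`equicontinuous`, `dense`, `interior`, `cauchy`; here they are re-proved VERBATIM from these
individual clauses (adapted from `Literature/Probability/Percolation/SmirnovSeparatingData.lean`),
so that they apply to the weak separating data `Sig.IsWeakSepData` of the line, whose boundary
clause is weaker. The last lemma, `tendsto_data_of_tendstoUniformlyOn`, is the first half of the
tree's `limit_boundary_open_of_separatingData`: along points `z_n ∈ S_{δ_n} ∩ Ω`, `z_n → z`, the
data `f_{δ_n}(z_n)` tend to `G(z)` for a uniform limit `G` of the interpolants.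

References: B. Bollobás, O. Riordan, *Percolation*, CUP 2006, Ch. 7 §7.2.6 pp. 196–201.
-/

noncomputable section

namespace Summit.CriticalPhenomena.CardyFormulaZ2.Theorems.BondTriangularCardyLine

open Set Filter Topology Metric MeasureTheory
open Literature.Probability.Percolation Literature.Probability.RandomPlanarGeometry
open Literature.Probability.RandomPlanarGeometry.MarkedDomain
open Literature.Probability.LatticeModels
open scoped BoundedContinuousFunction

variable {R : ConformalRectangle} {ω : ℂ} {S : ℝ → Finset ℂ} {f : ℝ → Fin 3 → ℂ → ℝ} {ε : ℝ → ℝ}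

/-- **`f ≤ g ≤ f + o(1)` on `S_δ`** for the McShane interpolants `g = dataFamily S f ε`, from the
clauses `mem_Icc` and `equicontinuous` only (Bollobás–Riordan 2006, (39) p. 200; adapted from
`dataFamily_approx`). [cite: BollobasRiordan2006, Ch. 7 (39) p. 200] -/
theorem dataFamily_approx_weak
    (hIcc : ∀ (δ : ℝ) (i : Fin 3), ∀ w ∈ S δ, f δ i w ∈ Icc (0 : ℝ) 1)
    (hequi : ∀ β > (0 : ℝ), ∃ η > (0 : ℝ), ∀ᶠ δ in 𝓝[>] (0 : ℝ), ∀ (i : Fin 3),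
      ∀ z ∈ S δ, ∀ w ∈ S δ, dist z w < η → f δ i z - f δ i w ≤ β)
    (hε : Tendsto ε (𝓝[>] 0) (𝓝 0)) {β : ℝ} (hβ : 0 < β) :
    ∀ᶠ δ in 𝓝[>] (0 : ℝ), ∀ (i : Fin 3), ∀ w ∈ S δ,
      f δ i w ≤ dataFamily S f ε δ i w ∧ dataFamily S f ε δ i w ≤ f δ i w + β := by
  -- adapted from `Literature.Probability.Percolation.dataFamily_approx`
  obtain ⟨η, hη, hev⟩ := hequi β hβ
  have hρ : ∀ᶠ δ in 𝓝[>] (0 : ℝ), interpScale ε δ < η :=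
    (tendsto_interpScale hε).eventually (gt_mem_nhds hη)
  have hpos : ∀ᶠ δ in 𝓝[>] (0 : ℝ), 0 < δ := eventually_mem_nhdsWithin
  filter_upwards [hev, hρ, hpos] with δ hev hρ hδ i w hw
  refine ⟨mcShane.le_self hw, ?_⟩
  obtain ⟨w', hw', hle, hd⟩ := mcShane.exists_le (interpScale_pos ε hδ)
    (fun v hv => (hIcc δ i v hv).1) (fun v hv => (hIcc δ i v hv).2) w hw
    (by rw [dist_self]; exact (interpScale_pos ε hδ).le)
  have := hev i w' hw' w hw (by rw [dist_comm]; exact lt_of_le_of_lt hd hρ)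
  unfold dataFamily
  linarith

/-- **The two-sided property of the interpolants** from `mem_Icc` only (Bollobás–Riordan 2006,
p. 197; adapted from `dataFamily_two_sided`). [cite: BollobasRiordan2006, Ch. 7 p. 197] -/
theorem dataFamily_two_sided_weak
    (hIcc : ∀ (δ : ℝ) (i : Fin 3), ∀ w ∈ S δ, f δ i w ∈ Icc (0 : ℝ) 1) {δ : ℝ} (hδ : 0 < δ)
    (hdense : ∀ z ∈ closure R.carrier, ∃ w ∈ S δ, dist z w ≤ ε δ) (h1 : max (ε δ) 0 ≤ 1)
    (i : Fin 3) {z : ℂ} (hz : z ∈ closure R.carrier) :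
    (∃ w ∈ S δ, dist z w ≤ interpScale ε δ ∧
        f δ i w - interpScale ε δ ≤ dataFamily S f ε δ i z) ∧
      ∃ w' ∈ S δ, dist z w' ≤ interpScale ε δ ∧ dataFamily S f ε δ i z ≤ f δ i w' := by
  -- adapted from `Literature.Probability.Percolation.dataFamily_two_sided`
  have hρ := interpScale_pos ε hδ
  obtain ⟨w₀, hw₀, hd₀⟩ := hdense z hz
  have hd₀' : dist z w₀ ≤ interpScale ε δ := hd₀.trans (le_interpScale ε hδ h1)
  constructor
  · refine ⟨w₀, hw₀, hd₀', ?_⟩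
    have hsub := mcShane.sub_le (F := f δ i) (ρ := interpScale ε δ) z hw₀
    have hq : dist z w₀ / interpScale ε δ ≤ interpScale ε δ := by
      refine le_trans ?_ (max_div_interpScale_le ε hδ)
      exact div_le_div_of_nonneg_right (hd₀.trans (le_max_left _ _)) hρ.le
    unfold dataFamily
    linarith
  · obtain ⟨w', hw', hle, hd⟩ := mcShane.exists_le hρ (fun v hv => (hIcc δ i v hv).1)
      (fun v hv => (hIcc δ i v hv).2) z hw₀ hd₀'
    exact ⟨w', hw', hd, hle⟩

/-- **Claim 22** (Bollobás–Riordan 2006, p. 197) from `mem_Icc`, `equicontinuous` and the density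
clause only: the interpolants are uniformly equicontinuous on `closure Ω`, uniformly in `δ > 0`
(adapted from `dataFamily_equicontinuous`). [cite: BollobasRiordan2006, Ch. 7 Claim 22 pp. 197–198] -/
theorem dataFamily_equicontinuous_weak
    (hIcc : ∀ (δ : ℝ) (i : Fin 3), ∀ w ∈ S δ, f δ i w ∈ Icc (0 : ℝ) 1)
    (hequi : ∀ β > (0 : ℝ), ∃ η > (0 : ℝ), ∀ᶠ δ in 𝓝[>] (0 : ℝ), ∀ (i : Fin 3),
      ∀ z ∈ S δ, ∀ w ∈ S δ, dist z w < η → f δ i z - f δ i w ≤ β)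
    (hε : Tendsto ε (𝓝[>] 0) (𝓝 0))
    (hdense : ∀ᶠ δ in 𝓝[>] (0 : ℝ), ∀ z ∈ closure R.carrier, ∃ w ∈ S δ, dist z w ≤ ε δ)
    (i : Fin 3) {β : ℝ} (hβ : 0 < β) :
    ∃ η > (0 : ℝ), ∀ δ, 0 < δ → ∀ z ∈ closure R.carrier, ∀ w ∈ closure R.carrier,
      dist z w < η → dist (dataFamily S f ε δ i z) (dataFamily S f ε δ i w) < β := by
  -- adapted from `Literature.Probability.Percolation.dataFamily_equicontinuous`
  obtain ⟨η₁, hη₁, hev⟩ := hequi (β / 3) (by positivity)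
  have hρ : ∀ᶠ δ in 𝓝[>] (0 : ℝ), interpScale ε δ < min (η₁ / 4) (β / 3) :=
    (tendsto_interpScale hε).eventually (gt_mem_nhds (by positivity))
  have h1 : ∀ᶠ δ in 𝓝[>] (0 : ℝ), max (ε δ) 0 ≤ 1 := by
    have : Tendsto (fun δ => max (ε δ) 0) (𝓝[>] 0) (𝓝 (max 0 0)) := hε.max tendsto_const_nhds
    rw [max_self] at this
    exact this.eventually (ge_mem_nhds one_pos)
  obtain ⟨δ₁, hδ₁, hgood⟩ := exists_forall_Ioo_of_eventually ((hev.and hρ).and (hdense.and h1))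
  have hs : 0 < Real.sqrt (2 * δ₁) := Real.sqrt_pos.2 (by positivity)
  refine ⟨min (η₁ / 2) (β / 2 * Real.sqrt (2 * δ₁)), by positivity, fun δ hδ z hz w hw hzw => ?_⟩
  have hzw₁ : dist z w < η₁ / 2 := lt_of_lt_of_le hzw (min_le_left _ _)
  have hzw₂ : dist z w < β / 2 * Real.sqrt (2 * δ₁) := lt_of_lt_of_le hzw (min_le_right _ _)
  by_cases hsmall : δ < δ₁
  · obtain ⟨⟨hev, hρ⟩, hdense, h1⟩ := hgood δ ⟨hδ, hsmall⟩
    have hρ₁ : interpScale ε δ < η₁ / 4 := lt_of_lt_of_le hρ (min_le_left _ _)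
    have hρ₂ : interpScale ε δ < β / 3 := lt_of_lt_of_le hρ (min_le_right _ _)
    -- the two-sided property at `z` and at `w`
    have key : ∀ z ∈ closure R.carrier, ∀ w ∈ closure R.carrier, dist z w < η₁ / 2 →
        dataFamily S f ε δ i z - dataFamily S f ε δ i w ≤ β / 3 + interpScale ε δ := by
      intro z hz w hw hzw
      obtain ⟨-, w', hw', hdw', hle⟩ := dataFamily_two_sided_weak hIcc hδ hdense h1 i hz
      obtain ⟨⟨w₀, hw₀, hdw₀, hge⟩, -⟩ := dataFamily_two_sided_weak hIcc hδ hdense h1 i hw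
      have hd : dist w' w₀ < η₁ := by
        calc dist w' w₀ ≤ dist w' z + dist z w + dist w w₀ := dist_triangle4 w' z w w₀
          _ < η₁ / 4 + η₁ / 2 + η₁ / 4 := by
            rw [dist_comm w' z]
            exact add_lt_add_of_lt_of_le (add_lt_add_of_le_of_lt (hdw'.trans_lt hρ₁).le hzw)
              (hdw₀.trans hρ₁.le)
          _ = η₁ := by ring
      have := hev i w' hw' w₀ hw₀ hd
      linarith
    have h12 := key z hz w hw hzw₁
    have h21 := key w hw z hz (by rwa [dist_comm])
    rw [Real.dist_eq, abs_lt]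
    constructor <;> linarith
  · push Not at hsmall
    have hρδ : Real.sqrt (2 * δ₁) ≤ interpScale ε δ :=
      (Real.sqrt_le_sqrt (by linarith)).trans (sqrt_le_interpScale ε δ)
    calc dist (dataFamily S f ε δ i z) (dataFamily S f ε δ i w)
        ≤ dist z w / interpScale ε δ := mcShane.dist_le (interpScale_pos ε hδ) z w
      _ ≤ dist z w / Real.sqrt (2 * δ₁) :=
          div_le_div_of_nonneg_left dist_nonneg hs hρδ
      _ < β / 2 * Real.sqrt (2 * δ₁) / Real.sqrt (2 * δ₁) := div_lt_div_of_pos_right hzw₂ hs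
      _ = β / 2 := mul_div_cancel_right₀ _ hs.ne'
      _ < β := by linarith

/-- **The data along convergent points tend to the limit of the interpolants** (first half of
the tree's `limit_boundary_open_of_separatingData`, Bollobás–Riordan 2006, (39) p. 200): if
`g_{δ_n} → G` uniformly on `closure Ω`, `G` continuous there, `z_n ∈ S_{δ_n} ∩ Ω` eventually and
`z_n → z`, then `f_{δ_n}(z_n) → G(z)`. [cite: BollobasRiordan2006, Ch. 7 (39) p. 200] -/
theorem tendsto_data_of_tendstoUniformlyOn
    (hIcc : ∀ (δ : ℝ) (i : Fin 3), ∀ w ∈ S δ, f δ i w ∈ Icc (0 : ℝ) 1)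
    (hequi : ∀ β > (0 : ℝ), ∃ η > (0 : ℝ), ∀ᶠ δ in 𝓝[>] (0 : ℝ), ∀ (i : Fin 3),
      ∀ z ∈ S δ, ∀ w ∈ S δ, dist z w < η → f δ i z - f δ i w ≤ β)
    (hε : Tendsto ε (𝓝[>] 0) (𝓝 0)) {u : ℕ → ℝ} (hu : Tendsto u atTop (𝓝[>] 0))
    {G : ℂ → ℝ} (hGc : ContinuousOn G (closure R.carrier)) (j : Fin 3)
    (hunif : TendstoUniformlyOn (fun n => dataFamily S f ε (u n) j) G atTop (closure R.carrier))
    {zs : ℕ → ℂ} (hzs : ∀ᶠ n in atTop, zs n ∈ S (u n) ∧ zs n ∈ R.carrier) {z : ℂ}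
    (hzt : Tendsto zs atTop (𝓝 z)) :
    Tendsto (fun n => f (u n) j (zs n)) atTop (𝓝 (G z)) := by
  -- adapted from `Literature.Probability.Percolation.limit_boundary_open_of_separatingData`
  have hzcl : z ∈ closure R.carrier := mem_closure_of_tendsto hzt (hzs.mono fun n hn => hn.2)
  have hzt' : Tendsto zs atTop (𝓝[closure R.carrier] z) :=
    tendsto_nhdsWithin_iff.2 ⟨hzt, hzs.mono fun n hn => subset_closure hn.2⟩
  -- `g_n(z_n) → G(z)`
  have hg : Tendsto (fun n => dataFamily S f ε (u n) j (zs n)) atTop (𝓝 (G z)) := by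
    have hGz : Tendsto (fun n => G (zs n)) atTop (𝓝 (G z)) := (hGc z hzcl).tendsto.comp hzt'
    rw [Metric.tendsto_atTop] at hGz ⊢
    intro η hη
    obtain ⟨M₁, hM₁⟩ := hGz (η / 2) (half_pos hη)
    obtain ⟨M₂, hM₂⟩ := eventually_atTop.1
      (((Metric.tendstoUniformlyOn_iff.1 hunif) (η / 2) (half_pos hη)).and hzs)
    refine ⟨max M₁ M₂, fun n hn => ?_⟩
    obtain ⟨h2, hmem⟩ := hM₂ n (le_of_max_le_right hn)
    have h1 := hM₁ n (le_of_max_le_left hn)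
    have h2' := h2 (zs n) (subset_closure hmem.2)
    calc dist (dataFamily S f ε (u n) j (zs n)) (G z)
        ≤ dist (dataFamily S f ε (u n) j (zs n)) (G (zs n)) + dist (G (zs n)) (G z) :=
          dist_triangle _ _ _
      _ < η / 2 + η / 2 := add_lt_add (by rwa [dist_comm]) h1
      _ = η := by ring
  -- `g_n(z_n) - f_n(z_n) → 0`
  have hgf : Tendsto (fun n => dataFamily S f ε (u n) j (zs n) - f (u n) j (zs n))
      atTop (𝓝 0) := by
    rw [Metric.tendsto_atTop]
    intro η hη
    obtain ⟨M, hM⟩ := eventually_atTop.1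
      ((hu.eventually (dataFamily_approx_weak hIcc hequi hε (half_pos hη))).and hzs)
    refine ⟨M, fun n hn => ?_⟩
    obtain ⟨happ, hmem⟩ := hM n hn
    have h := happ j (zs n) hmem.1
    rw [Real.dist_0_eq_abs, abs_lt]
    constructor <;> linarith [h.1, h.2]
  have := hg.sub hgf
  simp only [sub_zero] at this
  refine this.congr fun n => ?_
  ring

/-- **The Arzelà–Ascoli extraction** (Bollobás–Riordan 2006, proof of Thm. 2, p. 202, as in the
tree's `IsSmirnovFamily.tendsto_apply_one`): along any sequence of meshes `δ_n > 0` the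
interpolants `(g_{δ_n}⁰, g_{δ_n}¹, g_{δ_n}²)` — continuous, `[0, 1]`-valued, uniformly
equicontinuous on the compact set `closure Ω` — have a subsequence converging uniformly on
`closure Ω` to a triple `G` of functions continuous on the plane (Tietze extensions of the
limits). [cite: BollobasRiordan2006, Ch. 7 proof of Thm. 2 p. 202] -/
theorem exists_subseq_tendstoUniformlyOn_dataFamily :
    ∀ (R : Literature.Probability.RandomPlanarGeometry.ConformalRectangle) (S : ℝ → Finset ℂ)
      (f : ℝ → Fin 3 → ℂ → ℝ) (ε : ℝ → ℝ),
      (∀ (δ : ℝ) (i : Fin 3), ∀ w ∈ S δ, f δ i w ∈ Set.Icc (0 : ℝ) 1) →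
      (∀ β > (0 : ℝ), ∃ η > (0 : ℝ), ∀ᶠ δ in nhdsWithin (0 : ℝ) (Set.Ioi 0), ∀ (i : Fin 3),
        ∀ z ∈ S δ, ∀ w ∈ S δ, dist z w < η → f δ i z - f δ i w ≤ β) →
      Filter.Tendsto ε (nhdsWithin (0 : ℝ) (Set.Ioi 0)) (nhds 0) →
      (∀ᶠ δ in nhdsWithin (0 : ℝ) (Set.Ioi 0), ∀ z ∈ closure R.carrier,
        ∃ w ∈ S δ, dist z w ≤ ε δ) →
      ∀ (u : ℕ → ℝ), (∀ n, 0 < u n) →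
        ∃ φ : ℕ → ℕ, StrictMono φ ∧ ∃ G : Fin 3 → ℂ → ℝ, (∀ i, Continuous (G i)) ∧
          ∀ i, TendstoUniformlyOn
            (fun n => Literature.Probability.Percolation.dataFamily S f ε (u (φ n)) i) (G i)
            Filter.atTop (closure R.carrier) := by
  intro R S f ε hIcc hequi hε hdense u hupos
  -- adapted from `Literature.Probability.Percolation.IsSmirnovFamily.tendsto_apply_one`
  classical
  set g : ℝ → Fin 3 → ℂ → ℝ := dataFamily S f ε with hg_def
  -- Step 1: the compact set `K = closure Ω`.
  set K : Set ℂ := closure R.carrier with hK_def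
  have hK : IsCompact K := R.isBounded.isCompact_closure
  haveI : CompactSpace K := isCompact_iff_compactSpace.1 hK
  -- Step 2: the maps `Φ n : K →ᵇ (Fin 3 → ℝ)`.
  have hcont : ∀ n i, Continuous fun x : K => g (u n) i x := fun n i =>
    (continuous_dataFamily S f ε (hupos n) i).comp continuous_subtype_val
  let Φ : ℕ → K →ᵇ (Fin 3 → ℝ) := fun n =>
    BoundedContinuousFunction.mkOfCompact ⟨fun (x : K) i => g (u n) i x, continuous_pi (hcont n)⟩
  have hΦ : ∀ n (x : K) i, Φ n x i = g (u n) i x := fun _ _ _ => rfl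
  -- Step 3: the hypotheses of Arzelà–Ascoli.
  set B : Set (Fin 3 → ℝ) := Set.pi univ fun _ => Icc 0 1 with hB_def
  have hB : IsCompact B := isCompact_univ_pi fun _ => isCompact_Icc
  have hin : ∀ (F : K →ᵇ (Fin 3 → ℝ)) (x : K), F ∈ range Φ → F x ∈ B := by
    rintro _ x ⟨n, rfl⟩ i -
    exact mcShane.mem_Icc (interpScale_pos ε (hupos n)) (fun w hw => (hIcc (u n) i w hw).2) _
  have hequi' : Equicontinuous fun n => (Φ n : K → Fin 3 → ℝ) := by
    intro x₀
    rw [Metric.equicontinuousAt_iff]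
    intro e he
    choose η hη hη' using fun i =>
      dataFamily_equicontinuous_weak (R := R) hIcc hequi hε hdense i (half_pos he)
    refine ⟨min (η 0) (min (η 1) (η 2)), lt_min (hη 0) (lt_min (hη 1) (hη 2)), fun x hx n => ?_⟩
    rw [dist_pi_lt_iff he]
    intro i
    have hxi : dist (x : ℂ) x₀ < η i := by
      refine lt_of_lt_of_le hx ?_
      fin_cases i
      · exact min_le_left _ _
      · exact (min_le_right _ _).trans (min_le_left _ _)
      · exact (min_le_right _ _).trans (min_le_right _ _)
    calc dist (Φ n x₀ i) (Φ n x i) = dist (g (u n) i x₀) (g (u n) i x) := rfl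
      _ < e / 2 := hη' i _ (hupos n) _ x₀.2 _ x.2 (by rwa [dist_comm])
      _ < e := half_lt_self he
  have hequi'' : Equicontinuous ((↑) : range Φ → K → Fin 3 → ℝ) := by
    have h := hequi'.comp fun F : range Φ => F.2.choose
    convert h using 1
    funext F
    exact (congrArg (fun F : K →ᵇ (Fin 3 → ℝ) => (F : K → Fin 3 → ℝ)) F.2.choose_spec).symm
  -- Step 4: a uniformly convergent subsequence.
  have hcpt : IsCompact (closure (range Φ)) :=
    BoundedContinuousFunction.arzela_ascoli B hB (range Φ) hin hequi''
  obtain ⟨Glim, -, φ, hφ, hlim⟩ :=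
    hcpt.tendsto_subseq (x := Φ) fun n => subset_closure (mem_range_self n)
  have hunif : TendstoUniformly (fun n => (Φ (φ n) : K → Fin 3 → ℝ)) Glim atTop :=
    BoundedContinuousFunction.tendsto_iff_tendstoUniformly.1 hlim
  -- Step 5: the limits as continuous functions on `ℂ` (Tietze extensions of the components).
  have hext : ∀ i : Fin 3, ∃ Gt : ℂ → ℝ, Continuous Gt ∧ ∀ x : K, Gt x = Glim x i := by
    intro i
    let G₀ : C(K, ℝ) := ⟨fun x => Glim x i, (continuous_apply i).comp Glim.continuous⟩
    obtain ⟨Gt, hGt⟩ := ContinuousMap.exists_restrict_eq isClosed_closure G₀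
    refine ⟨Gt, Gt.continuous, fun x => ?_⟩
    have h := congrArg (fun g : C(K, ℝ) => g x) hGt
    simpa [G₀] using h
  choose G hGc hGK using hext
  refine ⟨φ, hφ, G, hGc, fun i => ?_⟩
  rw [tendstoUniformlyOn_iff_tendstoUniformly_comp_coe, Metric.tendstoUniformly_iff]
  intro e he
  filter_upwards [(Metric.tendstoUniformly_iff.1 hunif) e he] with n hn x
  calc dist ((G i ∘ (↑)) x) (g (u (φ n)) i x) = dist (Glim x i) (Φ (φ n) x i) := by
        rw [Function.comp_apply, hGK, hΦ]
    _ ≤ dist (Glim x) (Φ (φ n) x) := dist_le_pi_dist _ _ i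
    _ < e := hn x

end Summit.CriticalPhenomena.CardyFormulaZ2.Theorems.BondTriangularCardyLine

end
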